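import Mathlib
import HarnessLib
import Summits.Ventures.LatticeQCDFlow.Exactness.NCMCGeneralSpaceOccupancyChainGammaCoverage

/-!
# SCORER A's PRINTED `τ̂_int` IS CONSISTENT under a Doeblin POWER, from EVERY initial law: `Γ̂_N(t) → C_f̄(t)` and `tauIntWindow ρ̂_N W_N → σ²_f/(2 Var_π f)` in probability; for an event, `→ Scoring.tauInt (setACF κ π A)`; for the NCMC lane's occupancy, `→ τ_int(ρ_occ)` from every initial state

HONEST FRAMING: exact (Metropolis-corrected) sampling algorithms for lattice gauge theory;
figures of merit are autocorrelation/cost numbers at stated couplings and volumes; no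
continuum-physics claim.

Venture `LatticeQCDFlow` (cell pub-lqcd), topic `Exactness`; FANOUT row 13 (`eng-snf`, GEN-20).
NEW WORK of the cell, not a published result; no definition is introduced; nothing is cited as a
fact.  The FITNESS figure of merit of the cell is `τ_int` in scorer A's convention
(`Scoring.tauInt ρ = 1/2 + Σ_{t≥1} ρ t`, Madras–Sokal / Wolff); what scorer A PRINTS for a stream is
`tau_int_W = tauIntWindow ρ̂_N W` with `ρ̂_N = rhoHat y N` the sample autocorrelation (row 11's verbatim
typing `Scoring/SampleACFSumZero.lean`).  THIS FILE: along a chain with a Doeblin power, from EVERY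
initial law, at deterministic windows `W_N → ∞` with `W_N³/N → 0`: (i) every lag estimate is
consistent, `Γ̂_N(t) → C_f̄(t)` in probability (Chebyshev on `NCMCGeneralSpaceGammaMethodMSE`); (ii) the
printed `τ̂_{N,W_N} → τ_f := σ²_f/(2 C_f̄(0))` in probability whenever `Var_π f = C_f̄(0) > 0` (the
Γ-method variance `Γ̂(0) · 2 τ̂ → σ²_f` of `NCMCGeneralSpaceGammaMethodConsistency`, the product rule
for convergence in probability, and the event `Γ̂_N(0) = 0` — on which `τ̂ = 1/2` is the junk value of a
constant stretch — has vanishing probability); (iii) for the indicator of an event `A` with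
`0 < π(A) < 1`, `τ_f` IS `Scoring.tauInt (setACF κ π A)` (GEN-19's `greenKubo_indicator_eq_tauInt`,
row 9's `setAutocov_zero`), so the printed `τ̂` of a sector / level indicator converges to the FITNESS
`τ_int`; (iv) the NCMC lane: the printed `τ̂` of the occupancy series converges to `τ_int(ρ_occ)` from
EVERY initial state under GEN-18's two-step certificate.

## Content

* **`chain_gammaHat_tendstoInMeasure_of_nHit`** — fixed lag `t`: `Γ̂_N(t) → C_f̄(t)` in `P_{μ₀}`-measure.
* `tendstoInMeasure_of_eq_off_null` — transfer of convergence in probability across statistics that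
  agree off events of vanishing probability.
* **`chain_tauIntWindow_tendstoInMeasure_of_nHit`** — `Var_π f > 0`:
  `tauIntWindow (rhoHat (f ∘ X) N) (W N) → σ²_f/(2 C_f̄(0))` in `P_{μ₀}`-measure, every `μ₀`.
* **`chain_tauIntWindow_indicator_tendstoInMeasure_of_nHit`** — `0 < π(A) < 1`:
  `→ Scoring.tauInt (setACF κ π A)`; `…_of_minorised` — the one-step case `κ(z, ·) ≥ ε ν`.
* **`CrooksPair.ncmc_tauIntWindow_occupancy_tendstoInMeasure_of_sq`** — the NCMC lane, every initial
  state: `→ Scoring.tauInt (setACF Q π_c target)`; `…_of_exists_sq` and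
  `CrooksPair.ncmc_dFocc_coverage_gamma_of_exists_sq` — the same two NCMC statements from the
  EXISTENTIAL two-step certificate (GEN-18's `ncmc_exists_sq_doeblin_of_ne`: every `c ≠ ΔF` under
  the heat-bath shape).

NOT CLAIMED: the automatic window; almost-sure consistency; a rate; any number of ours.
-/

namespace Summit.Ventures.LatticeQCDFlow.Exactness.GeneralNCMC

open MeasureTheory ProbabilityTheory Set Filter Finset
open scoped ENNReal NNReal Topology

/-! ## §1 A transfer lemma -/

section Transfer

variable {Ω₀ : Type*} [MeasurableSpace Ω₀] {P : Measure Ω₀}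

/-- If `Z_n → c` in measure and `Y_n = Z_n` outside measurable events `E_n` with `P(E_n) → 0`, then
`Y_n → c` in measure. -/
theorem tendstoInMeasure_of_eq_off_null {Y Z : ℕ → Ω₀ → ℝ} {c : ℝ} {E : ℕ → Set Ω₀}
    (hZ : TendstoInMeasure P Z atTop (fun _ => c))
    (hE : Tendsto (fun n => P (E n)) atTop (𝓝 0))
    (heq : ∀ n x, x ∉ E n → Y n x = Z n x) :
    TendstoInMeasure P Y atTop (fun _ => c) := by
  intro δ hδ
  have hsub : ∀ n, {x | δ ≤ edist (Y n x) c} ⊆ {x | δ ≤ edist (Z n x) c} ∪ E n := by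
    intro n x hx
    by_cases hxE : x ∈ E n
    · exact Or.inr hxE
    · left
      simp only [Set.mem_setOf_eq] at hx ⊢
      rwa [heq n x hxE] at hx
  have h0 : Tendsto (fun n => P {x | δ ≤ edist (Z n x) c} + P (E n)) atTop (𝓝 0) := by
    simpa using (hZ δ hδ).add hE
  exact tendsto_of_tendsto_of_tendsto_of_le_of_le tendsto_const_nhds h0 (fun n => bot_le)
    fun n => (measure_mono (hsub n)).trans (measure_union_le _ _)

end Transfer

/-! ## §2 Consistency of the lag estimates and of the printed `τ̂` -/

section Chain

variable {S : Type*} [MeasurableSpace S]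
  {κ : Kernel S S} [IsMarkovKernel κ] {π : Measure S} [IsProbabilityMeasure π]
  {ν : Measure S} [IsProbabilityMeasure ν] {ε : ℝ≥0∞} {m : ℕ}
  (μ₀ : Measure S) [IsProbabilityMeasure μ₀]

/-- **Every lag estimate is consistent**: for fixed `t`, `Γ̂_N(t) → C_f̄(t)` in `P_{μ₀}`-measure, every
`μ₀` (`κ` Markov, `π` invariant, `(nHit κ m)(z,·) ≥ ε ν`, `ε ≠ 0`, `0 < m`, `|f| ≤ C`). -/
theorem chain_gammaHat_tendstoInMeasure_of_nHit (hπ : Kernel.Invariant κ π)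
    (hε : ε ≠ 0) (hmin : ∀ z, ε • ν ≤ nHit κ m z) (hm : 0 < m)
    {f : S → ℝ} (hf : Measurable f) {C : ℝ} (hC : ∀ x, |f x| ≤ C) (t : ℕ) :
    TendstoInMeasure (Kernel.trajMeasure (X := fun _ : ℕ => S) μ₀
        (fun n : ℕ => κ.comap (fun h : (i : ↥(Finset.Iic n)) → S => h ⟨n, Finset.mem_Iic.2 le_rfl⟩)
          (measurable_pi_apply _)))
      (fun (N : ℕ) (x : ℕ → S) => Scoring.gammaHat (fun i => f (x i)) N t)
      atTop (fun _ => Scoring.autocov κ π (fun y => f y - ∫ z, f z ∂π) t) := by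
  set P := Kernel.trajMeasure (X := fun _ : ℕ => S) μ₀
      (fun n : ℕ => κ.comap (fun h : (i : ↥(Finset.Iic n)) → S => h ⟨n, Finset.mem_Iic.2 le_rfl⟩)
        (measurable_pi_apply _)) with hP
  haveI : Nonempty S := nonempty_of_isProbabilityMeasure μ₀
  have hε1 : ε ≤ 1 := by
    haveI := isMarkovKernel_nHit κ m
    exact eps_le_one_of_minorised hmin
  have hε0 : 0 < ε := pos_iff_ne_zero.2 hε
  set a := Scoring.autocov κ π (fun y => f y - ∫ z, f z ∂π) t with ha
  set K : ℝ := C ^ 4 * (2112 + 1024 * (t : ℝ) + 4224 * m / ε.toReal + 512 * (m / ε.toReal) ^ 2)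
    with hK
  have hbnd : Tendsto (fun N : ℕ => K / (N : ℝ)) atTop (𝓝 0) :=
    tendsto_const_nhds.div_atTop tendsto_natCast_atTop_atTop
  rw [tendstoInMeasure_iff_measureReal_norm]
  intro δ hδ
  have hδ2 : 0 < δ ^ 2 := by positivity
  refine squeeze_zero' (Eventually.of_forall fun n => measureReal_nonneg) ?_
    (by simpa using hbnd.div_const (δ ^ 2))
  filter_upwards [Filter.eventually_ge_atTop (2 * t + 1)] with N hN
  have hN0 : 0 < N := by omega
  have hmse := chain_mse_gammaHat_le_of_nHit μ₀ (fun z B hB => minorised_setwise hmin z hB) hε0 hε1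
    hm hπ hf hC (show 2 * t ≤ N by omega) hN0
  rw [← hP] at hmse
  set D : (ℕ → S) → ℝ := fun x => Scoring.gammaHat (fun i => f (x i)) N t - a with hD
  have hDm : Measurable D := (measurable_gammaHat_comp hf N t).sub measurable_const
  have hset : {x : ℕ → S | δ ≤ ‖Scoring.gammaHat (fun i => f (x i)) N t - a‖} = {x | δ ^ 2 ≤ D x ^ 2} := by
    ext x
    simp only [Set.mem_setOf_eq, Real.norm_eq_abs]
    constructor
    · intro h
      calc δ ^ 2 ≤ |D x| ^ 2 := pow_le_pow_left₀ hδ.le h 2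
        _ = D x ^ 2 := sq_abs _
    · intro h
      have h' := Real.sqrt_le_sqrt h
      rw [Real.sqrt_sq hδ.le, Real.sqrt_sq_eq_abs] at h'
      exact h'
  rw [hset]
  have hiD2 : Integrable (fun x => D x ^ 2) P :=
    Scoring.integrable_of_bounded P (hDm.pow_const 2) (C := ((2 * C) ^ 2 + |a|) ^ 2) fun x => by
      rw [abs_pow]
      exact pow_le_pow_left₀ (abs_nonneg _) ((abs_sub _ _).trans
        (add_le_add (abs_gammaHat_comp_le hC x N t) le_rfl)) 2
  have hcheb := mul_meas_ge_le_integral_of_nonneg (μ := P) (ae_of_all _ fun x => sq_nonneg (D x))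
    hiD2 (δ ^ 2)
  calc P.real {x | δ ^ 2 ≤ D x ^ 2} ≤ (∫ x, D x ^ 2 ∂P) / δ ^ 2 := by
        rw [le_div_iff₀ hδ2, mul_comm]; exact hcheb
    _ ≤ K / N / δ ^ 2 := div_le_div_of_nonneg_right hmse hδ2.le

/-- **THE PRINTED `τ̂_{N,W_N}` IS CONSISTENT.**  `κ` Markov, `π` invariant, `(nHit κ m)(z,·) ≥ ε ν`
(`ε ≠ 0`, `0 < m`), `|f| ≤ C` measurable with `Var_π f = C_f̄(0) > 0`; windows `W_N → ∞`,
`W_N³/N → 0`.  For EVERY initial law `μ₀`: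
`tauIntWindow (rhoHat (f ∘ X) N) (W N) → σ²_f / (2 C_f̄(0))` in `P_{μ₀}`-measure. -/
theorem chain_tauIntWindow_tendstoInMeasure_of_nHit (hπ : Kernel.Invariant κ π)
    (hε : ε ≠ 0) (hmin : ∀ z, ε • ν ≤ nHit κ m z) (hm : 0 < m)
    {f : S → ℝ} (hf : Measurable f) {C : ℝ} (hC : ∀ x, |f x| ≤ C)
    (hvar : 0 < Scoring.autocov κ π (fun y => f y - ∫ z, f z ∂π) 0)
    {W : ℕ → ℕ} (hW : Tendsto W atTop atTop) (hW3 : Tendsto (fun N => (W N : ℝ) ^ 3 / N) atTop (𝓝 0)) :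
    TendstoInMeasure (Kernel.trajMeasure (X := fun _ : ℕ => S) μ₀
        (fun n : ℕ => κ.comap (fun h : (i : ↥(Finset.Iic n)) → S => h ⟨n, Finset.mem_Iic.2 le_rfl⟩)
          (measurable_pi_apply _)))
      (fun (N : ℕ) (x : ℕ → S) => Scoring.tauIntWindow (Scoring.rhoHat (fun i => f (x i)) N) (W N))
      atTop (fun _ => (Scoring.autocov κ π (fun y => f y - ∫ z, f z ∂π) 0
          + 2 * ∑' t, Scoring.autocov κ π (fun y => f y - ∫ z, f z ∂π) (t + 1))
        / (2 * Scoring.autocov κ π (fun y => f y - ∫ z, f z ∂π) 0)) := by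
  set P := Kernel.trajMeasure (X := fun _ : ℕ => S) μ₀
      (fun n : ℕ => κ.comap (fun h : (i : ↥(Finset.Iic n)) → S => h ⟨n, Finset.mem_Iic.2 le_rfl⟩)
        (measurable_pi_apply _)) with hP
  haveI : Nonempty S := nonempty_of_isProbabilityMeasure μ₀
  have hε1 : ε ≤ 1 := by
    haveI := isMarkovKernel_nHit κ m
    exact eps_le_one_of_minorised hmin
  have hε0 : 0 < ε := pos_iff_ne_zero.2 hε
  set c0 := Scoring.autocov κ π (fun y => f y - ∫ z, f z ∂π) 0 with hc0
  set σ2 := c0 + 2 * ∑' t, Scoring.autocov κ π (fun y => f y - ∫ z, f z ∂π) (t + 1) with hσ2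
  -- `Γ̂(0) · 2 τ̂ → σ²` and `Γ̂(0) → c0 > 0`
  have hS := chain_gammaWindow_tendstoInMeasure_of_nHit μ₀ (fun z B hB => minorised_setwise hmin z hB)
    hε0 hε1 hm hπ hf hC hW hW3
  have hG := chain_gammaHat_tendstoInMeasure_of_nHit μ₀ hπ hε hmin hm hf hC 0
  rw [← hP] at hS hG
  have hGm : ∀ N, Measurable fun x : ℕ → S => Scoring.gammaHat (fun i => f (x i)) N 0 := fun N =>
    measurable_gammaHat_comp hf N 0
  have hSm : ∀ N, Measurable fun x : ℕ → S => Scoring.gammaHat (fun i => f (x i)) N 0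
      * (2 * Scoring.tauIntWindow (Scoring.rhoHat (fun i => f (x i)) N) (W N)) := fun N =>
    measurable_gammaWindow hf N (W N)
  -- `(2 Γ̂(0))⁻¹ → (2 c0)⁻¹`
  have hinv : TendstoInMeasure P (fun (N : ℕ) (x : ℕ → S) =>
      (2 * Scoring.gammaHat (fun i => f (x i)) N 0)⁻¹) atTop (fun _ => (2 * c0)⁻¹) := by
    have h2 : TendstoInMeasure P (fun (N : ℕ) (x : ℕ → S) =>
        2 * Scoring.gammaHat (fun i => f (x i)) N 0) atTop (fun _ => 2 * c0) := by
      have hc : TendstoInMeasure P (fun (_ : ℕ) (_ : ℕ → S) => (2 : ℝ)) atTop (fun _ => (2 : ℝ)) :=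
        tendstoInMeasure_of_tendsto_ae (fun _ => aestronglyMeasurable_const)
          (ae_of_all _ fun _ => tendsto_const_nhds)
      exact TendstoInMeasure.mul_const_lim hc hG (fun _ => measurable_const) hGm
    exact tendstoInMeasure_comp_continuousAt (g := fun v : ℝ => v⁻¹) h2
      (continuousAt_inv₀ (by positivity)) (fun N => ((hGm N).const_mul 2).inv)
  -- the ratio `Z_N = (Γ̂(0) · 2 τ̂) · (2 Γ̂(0))⁻¹ → σ² (2 c0)⁻¹`
  have hZ := TendstoInMeasure.mul_const_lim hS hinv hSm (fun N => ((hGm N).const_mul 2).inv)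
  rw [show σ2 / (2 * c0) = σ2 * (2 * c0)⁻¹ from div_eq_mul_inv _ _]
  -- `τ̂ = Z_N` off the event `Γ̂_N(0) = 0`, whose probability vanishes
  refine tendstoInMeasure_of_eq_off_null hZ (E := fun N => {x : ℕ → S |
    c0 ≤ ‖Scoring.gammaHat (fun i => f (x i)) N 0 - c0‖}) ?_ ?_
  · have h := (tendstoInMeasure_iff_norm.1 hG) c0 hvar
    exact h
  · intro N x hx
    simp only [Set.mem_setOf_eq, not_le, Real.norm_eq_abs] at hx
    have hne : Scoring.gammaHat (fun i => f (x i)) N 0 ≠ 0 := by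
      intro h0
      rw [h0, zero_sub, abs_neg, abs_of_pos hvar] at hx
      exact lt_irrefl _ hx
    field_simp

/-- **For an event, the printed `τ̂` converges to the FITNESS `τ_int`**: `0 < π(A) < 1`, windows as
above; for EVERY initial law `μ₀`:
`tauIntWindow (rhoHat (1_A ∘ X) N) (W N) → Scoring.tauInt (setACF κ π A)` in `P_{μ₀}`-measure. -/
theorem chain_tauIntWindow_indicator_tendstoInMeasure_of_nHit (hπ : Kernel.Invariant κ π)
    (hε : ε ≠ 0) (hmin : ∀ z, ε • ν ≤ nHit κ m z) (hm : 0 < m)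
    {A : Set S} (hA : MeasurableSet A) (h0 : 0 < π.real A) (h1 : π.real A < 1)
    {W : ℕ → ℕ} (hW : Tendsto W atTop atTop) (hW3 : Tendsto (fun N => (W N : ℝ) ^ 3 / N) atTop (𝓝 0)) :
    TendstoInMeasure (Kernel.trajMeasure (X := fun _ : ℕ => S) μ₀
        (fun n : ℕ => κ.comap (fun h : (i : ↥(Finset.Iic n)) → S => h ⟨n, Finset.mem_Iic.2 le_rfl⟩)
          (measurable_pi_apply _)))
      (fun (N : ℕ) (x : ℕ → S) =>
        Scoring.tauIntWindow (Scoring.rhoHat (fun i => A.indicator (1 : S → ℝ) (x i)) N) (W N))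
      atTop (fun _ => Scoring.tauInt (setACF κ π A)) := by
  have hf : Measurable (A.indicator (1 : S → ℝ)) := measurable_one.indicator hA
  have hC : ∀ y, |A.indicator (1 : S → ℝ) y| ≤ 1 := fun y => by
    by_cases hy : y ∈ A <;> simp [hy]
  have hmean : ∫ z, A.indicator (1 : S → ℝ) z ∂π = π.real A := integral_indicator_one hA
  have hc0 : Scoring.autocov κ π (fun y => A.indicator (1 : S → ℝ) y - ∫ z, A.indicator 1 z ∂π) 0
      = π.real A * (1 - π.real A) := by
    rw [hmean, autocov_centredIndicator_eq_setAutocov hπ hA 0, setAutocov_zero hA]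
  have hv0 : 0 < π.real A * (1 - π.real A) := mul_pos h0 (sub_pos.2 h1)
  have hσ2 : Scoring.autocov κ π (fun y => A.indicator (1 : S → ℝ) y - ∫ z, A.indicator 1 z ∂π) 0
      + 2 * ∑' t, Scoring.autocov κ π
        (fun y => A.indicator (1 : S → ℝ) y - ∫ z, A.indicator 1 z ∂π) (t + 1)
      = 2 * Scoring.tauInt (setACF κ π A) * (π.real A * (1 - π.real A)) := by
    rw [← cltVariance_eq_autocov κ π, greenKubo_indicator_eq_tauInt hπ hA h0 h1]
  have h := chain_tauIntWindow_tendstoInMeasure_of_nHit μ₀ hπ hε hmin hm hf hC (by rw [hc0]; exact hv0)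
    hW hW3
  have hne : 2 * (π.real A * (1 - π.real A)) ≠ 0 := by positivity
  rw [hσ2, hc0, show 2 * Scoring.tauInt (setACF κ π A) * (π.real A * (1 - π.real A))
      / (2 * (π.real A * (1 - π.real A))) = Scoring.tauInt (setACF κ π A) by
        rw [mul_comm (2 : ℝ) (Scoring.tauInt _), mul_assoc, mul_div_assoc, div_self hne, mul_one]] at h
  exact h

/-- **One-step minorisation** (`κ(z, ·) ≥ ε ν`: rows 8 / 9's samplers — heat-bath sweeps, the
exact flow sampler with a weight bound): the printed `τ̂` of an event converges to the FITNESS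
`Scoring.tauInt (setACF κ π A)` in probability, every `μ₀`. -/
theorem chain_tauIntWindow_indicator_tendstoInMeasure_of_minorised (hπ : Kernel.Invariant κ π)
    (hε : ε ≠ 0) (hmin : ∀ z, ε • ν ≤ κ z)
    {A : Set S} (hA : MeasurableSet A) (h0 : 0 < π.real A) (h1 : π.real A < 1)
    {W : ℕ → ℕ} (hW : Tendsto W atTop atTop) (hW3 : Tendsto (fun N => (W N : ℝ) ^ 3 / N) atTop (𝓝 0)) :
    TendstoInMeasure (Kernel.trajMeasure (X := fun _ : ℕ => S) μ₀
        (fun n : ℕ => κ.comap (fun h : (i : ↥(Finset.Iic n)) → S => h ⟨n, Finset.mem_Iic.2 le_rfl⟩)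
          (measurable_pi_apply _)))
      (fun (N : ℕ) (x : ℕ → S) =>
        Scoring.tauIntWindow (Scoring.rhoHat (fun i => A.indicator (1 : S → ℝ) (x i)) N) (W N))
      atTop (fun _ => Scoring.tauInt (setACF κ π A)) := by
  have hmin' : ∀ z, ε • ν ≤ nHit κ 1 z := fun z => by rw [nHit_one]; exact hmin z
  exact chain_tauIntWindow_indicator_tendstoInMeasure_of_nHit μ₀ hπ hε hmin' Nat.one_pos hA h0 h1 hW hW3

end Chain

/-! ## §3 The NCMC lane: the printed `τ̂` of the occupancy series -/

section NCMC

variable {Ω E : Type*} [MeasurableSpace Ω] [MeasurableSpace E]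
  {ν₀ ν₁ : Measure Ω} [IsFiniteMeasure ν₀] [IsFiniteMeasure ν₁]
  {κF κR : Kernel Ω E} [IsMarkovKernel κF] [IsMarkovKernel κR] {s e : E → Ω} {W : E → ℝ} {c : ℝ}
  {T₀ T₁ : Kernel Ω Ω} [IsMarkovKernel T₀] [IsMarkovKernel T₁] {ε : ℝ≥0∞}
  {ν : Measure (Bool × Ω)} [IsProbabilityMeasure ν]

/-- **THE NCMC LANE: the printed `τ̂` of the occupancy series converges to `τ_int(ρ_occ)` from EVERY
initial state** (Crooks pair, level samplers leaving `ν₀, ν₁` invariant, `ε • ν ≤ nHit Q 2 z`, `ε ≠ 0`,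
`e^{−ΔF} = Z₁/Z₀`; windows `W_n → ∞`, `W_n³/n → 0`). -/
theorem CrooksPair.ncmc_tauIntWindow_occupancy_tendstoInMeasure_of_sq (h : CrooksPair ν₀ ν₁ κF κR s e W)
    (h0 : ν₀ univ ≠ 0) (h1 : ν₁ univ ≠ 0) (hT₀ : Kernel.Invariant T₀ ν₀)
    (hT₁ : Kernel.Invariant T₁ ν₁) (hε : ε ≠ 0)
    (hD : haveI := isMarkovKernel_switchKernel (κF := κF) (κR := κR) (c := c)
              h.measurable_W h.measurable_s h.measurable_e
      ∀ z, ε • ν ≤ nHit (switchKernel κF κR c W s e ∘ₖ levelKernel T₀ T₁) 2 z)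
    {ΔF : ℝ} (hΔF : Real.exp (-ΔF) = ((ν₀ univ)⁻¹ * ν₁ univ).toReal)
    {Wn : ℕ → ℕ} (hW : Tendsto Wn atTop atTop) (hW3 : Tendsto (fun N => (Wn N : ℝ) ^ 3 / N) atTop (𝓝 0))
    (z₀ : Bool × Ω) :
    haveI := isMarkovKernel_switchKernel (κF := κF) (κR := κR) (c := c)
      h.measurable_W h.measurable_s h.measurable_e
    haveI := isMarkovKernel_levelKernel T₀ T₁
    TendstoInMeasure (Kernel.trajMeasure (X := fun _ : ℕ => Bool × Ω) (Measure.dirac z₀)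
        (fun n : ℕ => (switchKernel κF κR c W s e ∘ₖ levelKernel T₀ T₁).comap
          (fun hh : (j : ↥(Finset.Iic n)) → Bool × Ω => hh ⟨n, Finset.mem_Iic.2 le_rfl⟩)
          (measurable_pi_apply _)))
      (fun (n : ℕ) (x : ℕ → Bool × Ω) => Scoring.tauIntWindow (Scoring.rhoHat
        (fun i => (targetLevel Ω).indicator (1 : Bool × Ω → ℝ) (x i)) n) (Wn n))
      atTop (fun _ => Scoring.tauInt (setACF (switchKernel κF κR c W s e ∘ₖ levelKernel T₀ T₁)
        ((jointWeight c ν₀ ν₁ univ)⁻¹ • jointWeight c ν₀ ν₁) (targetLevel Ω))) := by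
  haveI := isMarkovKernel_switchKernel (κF := κF) (κR := κR) (c := c)
    h.measurable_W h.measurable_s h.measurable_e
  haveI := isMarkovKernel_levelKernel T₀ T₁
  haveI := isProbabilityMeasure_jointLaw c ν₀ ν₁ h0
  have hπ : Kernel.Invariant (switchKernel κF κR c W s e ∘ₖ levelKernel T₀ T₁)
      ((jointWeight c ν₀ ν₁ univ)⁻¹ • jointWeight c ν₀ ν₁) :=
    invariant_smul _ (iteration_invariant h hT₀ hT₁ c) _
  have hσeq := jointLaw_real_targetLevel c ν₀ ν₁ h0 h1 hΔF
  have hp0 : 0 < ((jointWeight c ν₀ ν₁ univ)⁻¹ • jointWeight c ν₀ ν₁).real (targetLevel Ω) := by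
    rw [hσeq]; exact Real.sigmoid_pos _
  have hp1 : ((jointWeight c ν₀ ν₁ univ)⁻¹ • jointWeight c ν₀ ν₁).real (targetLevel Ω) < 1 := by
    rw [hσeq]; exact Real.sigmoid_lt_one _
  exact chain_tauIntWindow_indicator_tendstoInMeasure_of_nHit (Measure.dirac z₀) hπ hε hD
    (by norm_num) measurableSet_targetLevel hp0 hp1 hW hW3

/-- The same with the EXISTENTIAL two-step certificate (GEN-18's `ncmc_exists_sq_doeblin_of_ne`
supplies it for every `c ≠ ΔF` under the heat-bath shape). -/
theorem CrooksPair.ncmc_tauIntWindow_occupancy_tendstoInMeasure_of_exists_sq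
    (h : CrooksPair ν₀ ν₁ κF κR s e W)
    (h0 : ν₀ univ ≠ 0) (h1 : ν₁ univ ≠ 0) (hT₀ : Kernel.Invariant T₀ ν₀)
    (hT₁ : Kernel.Invariant T₁ ν₁)
    (hex : ∃ (ε : ℝ≥0∞) (ν : Measure (Bool × Ω)), IsProbabilityMeasure ν ∧ ε ≠ 0 ∧
      ∀ z, ε • ν ≤ nHit (switchKernel κF κR c W s e ∘ₖ levelKernel T₀ T₁) 2 z)
    {ΔF : ℝ} (hΔF : Real.exp (-ΔF) = ((ν₀ univ)⁻¹ * ν₁ univ).toReal)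
    {Wn : ℕ → ℕ} (hW : Tendsto Wn atTop atTop) (hW3 : Tendsto (fun N => (Wn N : ℝ) ^ 3 / N) atTop (𝓝 0))
    (z₀ : Bool × Ω) :
    haveI := isMarkovKernel_switchKernel (κF := κF) (κR := κR) (c := c)
      h.measurable_W h.measurable_s h.measurable_e
    haveI := isMarkovKernel_levelKernel T₀ T₁
    TendstoInMeasure (Kernel.trajMeasure (X := fun _ : ℕ => Bool × Ω) (Measure.dirac z₀)
        (fun n : ℕ => (switchKernel κF κR c W s e ∘ₖ levelKernel T₀ T₁).comap
          (fun hh : (j : ↥(Finset.Iic n)) → Bool × Ω => hh ⟨n, Finset.mem_Iic.2 le_rfl⟩)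
          (measurable_pi_apply _)))
      (fun (n : ℕ) (x : ℕ → Bool × Ω) => Scoring.tauIntWindow (Scoring.rhoHat
        (fun i => (targetLevel Ω).indicator (1 : Bool × Ω → ℝ) (x i)) n) (Wn n))
      atTop (fun _ => Scoring.tauInt (setACF (switchKernel κF κR c W s e ∘ₖ levelKernel T₀ T₁)
        ((jointWeight c ν₀ ν₁ univ)⁻¹ • jointWeight c ν₀ ν₁) (targetLevel Ω))) := by
  obtain ⟨ε, ν, hν, hε, hD⟩ := hex
  haveI := hν
  exact h.ncmc_tauIntWindow_occupancy_tendstoInMeasure_of_sq h0 h1 hT₀ hT₁ hε hD hΔF hW hW3 z₀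

/-- `NCMCGeneralSpaceOccupancyChainGammaCoverage.CrooksPair.ncmc_dFocc_coverage_gamma_of_sq` with the
EXISTENTIAL two-step certificate. -/
theorem CrooksPair.ncmc_dFocc_coverage_gamma_of_exists_sq (h : CrooksPair ν₀ ν₁ κF κR s e W)
    (h0 : ν₀ univ ≠ 0) (h1 : ν₁ univ ≠ 0) (hT₀ : Kernel.Invariant T₀ ν₀)
    (hT₁ : Kernel.Invariant T₁ ν₁)
    (hex : ∃ (ε : ℝ≥0∞) (ν : Measure (Bool × Ω)), IsProbabilityMeasure ν ∧ ε ≠ 0 ∧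
      ∀ z, ε • ν ≤ nHit (switchKernel κF κR c W s e ∘ₖ levelKernel T₀ T₁) 2 z)
    {ΔF : ℝ} (hΔF : Real.exp (-ΔF) = ((ν₀ univ)⁻¹ * ν₁ univ).toReal)
    (hτ : haveI := isMarkovKernel_switchKernel (κF := κF) (κR := κR) (c := c)
              h.measurable_W h.measurable_s h.measurable_e
      0 < Scoring.tauInt (setACF (switchKernel κF κR c W s e ∘ₖ levelKernel T₀ T₁)
        ((jointWeight c ν₀ ν₁ univ)⁻¹ • jointWeight c ν₀ ν₁) (targetLevel Ω)))
    {Wn : ℕ → ℕ} (hW : Tendsto Wn atTop atTop) (hW3 : Tendsto (fun N => (Wn N : ℝ) ^ 3 / N) atTop (𝓝 0))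
    (z₀ : Bool × Ω) {z : ℝ} (hz : 0 < z)
    [hP : haveI := isMarkovKernel_switchKernel (κF := κF) (κR := κR) (c := c)
              h.measurable_W h.measurable_s h.measurable_e
      haveI := isMarkovKernel_levelKernel T₀ T₁
      IsProbabilityMeasure (Kernel.trajMeasure (X := fun _ : ℕ => Bool × Ω) (Measure.dirac z₀)
        (fun n : ℕ => (switchKernel κF κR c W s e ∘ₖ levelKernel T₀ T₁).comap
          (fun hh : (j : ↥(Finset.Iic n)) → Bool × Ω => hh ⟨n, Finset.mem_Iic.2 le_rfl⟩)
          (measurable_pi_apply _)))] :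
    haveI := isMarkovKernel_switchKernel (κF := κF) (κR := κR) (c := c)
      h.measurable_W h.measurable_s h.measurable_e
    haveI := isMarkovKernel_levelKernel T₀ T₁
    Tendsto (fun n : ℕ => (Kernel.trajMeasure (X := fun _ : ℕ => Bool × Ω) (Measure.dirac z₀)
        (fun n : ℕ => (switchKernel κF κR c W s e ∘ₖ levelKernel T₀ T₁).comap
          (fun hh : (j : ↥(Finset.Iic n)) → Bool × Ω => hh ⟨n, Finset.mem_Iic.2 le_rfl⟩)
          (measurable_pi_apply _)))
        {x : ℕ → Bool × Ω | |Real.sqrt n * ((c - Real.log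
            ((∑ i ∈ range n, (targetLevel Ω).indicator (1 : Bool × Ω → ℝ) (x i)) / n /
              (1 - (∑ i ∈ range n, (targetLevel Ω).indicator (1 : Bool × Ω → ℝ) (x i)) / n)))
            - ΔF)
          * Real.sqrt ((∑ i ∈ range n, (targetLevel Ω).indicator (1 : Bool × Ω → ℝ) (x i)) / n
            * (1 - (∑ i ∈ range n, (targetLevel Ω).indicator (1 : Bool × Ω → ℝ) (x i)) / n)
            / (2 * Scoring.tauIntWindow (Scoring.rhoHat
              (fun i => (targetLevel Ω).indicator (1 : Bool × Ω → ℝ) (x i)) n) (Wn n)))| ≤ z})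
      atTop (𝓝 (gaussianReal 0 1 (Icc (-z) z))) := by
  obtain ⟨ε, ν, hν, hε, hD⟩ := hex
  haveI := hν
  exact h.ncmc_dFocc_coverage_gamma_of_sq h0 h1 hT₀ hT₁ hε hD hΔF hτ hW hW3 z₀ hz

end NCMC

end Summit.Ventures.LatticeQCDFlow.Exactness.GeneralNCMC
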